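import Literature.MathematicalPhysics.QuantumFieldTheory.Balaban1983to89.Beta.WilsonVertex2
import Literature.MathematicalPhysics.QuantumFieldTheory.Balaban1983to89.Beta.PlaquetteVertex

/-!
# The lattice `(2,2)`-jet of the Wilson plaquette sum: second-order transport functionals in lattice indexing, the four-form
# normal form `jet22 = transport₂ + seagull + spinTransport + contact`, degenerate words, constant fields

HONEST FRAMING (cell `pub-balaban`, β sub-cell, lineage an3; verbatim): discharging `BetaPertH` makes Bałaban's UV stability
UNCONDITIONAL — a real constructive-QFT result; it is NOT the continuum limit and NOT the Clay problem.  This file discharges NOTHING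
of `BetaPertH`: it is ring-level and lattice-level bookkeeping of the `(W², B²)` Taylor jet of the Wilson plaquette sum, the an3-owned
input of the SECOND-ORDER background-vertex family (the `W`-slot of a one-step jet datum).  ABSOLUTE RULE of the cell: no internally
minted statement enters as a cited fact; every declaration below is a definition or is kernel-proved here from the two imports;
NOTHING is cited.  The manuscripts under audit are not citable for their disputed steps and are not cited here.

SETTING.  As in `Beta.PlaquetteVertex`: a lattice `Λ` (an additive commutative group; finite where sums over sites occur), directions
`D`, unit steps `e : D → Λ`, link variables `U_b = e^{W_b} e^{B_b}` with a FLUCTUATION letter field `W : Λ → D → 𝔸` and a BACKGROUND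
letter field `B : Λ → D → 𝔸` in a normed `𝕜`-algebra `𝔸` (`𝕜 = ℝ` or `ℂ`), the oriented plaquette word
`plaqWord e W B x μ ν = U_μ(x) U_ν(x+e_μ) U_μ(x+e_ν)⁻¹ U_ν(x)⁻¹` (`PlaquetteVertex.plaqWord`, `WilsonVertex.plaq`), the lattice curl
`lcurl e X x μ ν = (X(x+e_μ) ν − X x ν) − (X(x+e_ν) μ − X x μ)` and the first-order transport sum `twistW` of `Beta.PlaquetteVertex`.
`Beta.WilsonVertex2` supplies, for two-sorted words of any length, the exact bidegree-`(2,2)` Taylor component `P22` (BCH-free), the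
second-order transport functionals `ad₂`, `twist₂Aux`, `qtwistAux`, `ctwistAux`, the factorisation `P22_eq_transport` and the tracial
normal form `trace_P22`.  This file instantiates them at the plaquette words of a lattice configuration and sums over the lattice.

CONTENT (all [folklore]: definitions, finite sums and polynomial identities in an associative algebra).
* §1 LATTICE SECOND-ORDER TRANSPORT FUNCTIONALS of the plaquette `p_{μν}(x)` (letters `W₁ = W_μ(x)`, `W₂ = W_ν(x+e_μ)`,
  `W₃ = W_μ(x+e_ν)`, `W₄ = W_ν(x)`, `B` likewise; `F = F_{μν}(x) = lcurl e B x μ ν = B₁ + B₂ − B₃ − B₄`):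
  `twist₂W` (the `B`-QUADRATIC transport of the later fluctuation letters, `Σ_i ±ad₂(β_i, c_i)(W_i)` with the accumulated backgrounds
  `β₃ = F + B₄`, `β₄ = F` and accumulated commutators `c_i`; `twist₂Aux_plaqWord`, the regrouping `twist₂W_regroup` through `F` and the
  THREE-GRADED SPLIT `twist₂W_split` into an `F`-free part, an `F`-linear part and the `F`-quadratic part `−½[F,[F, W₃ + W₄]]`);
  `qtwistW` (the `B`-LINEAR part of `quad` of the transported fluctuation letters; `qtwistW_eq` explicit), `ctwistW`
  (`ctwistAux_plaqWord`) with `two_smul_qtwistW : 2•qtwistW = (lcurl W)·twistW + twistW·(lcurl W) + ctwistW`; `two_smul_quad_wpart_plaqWord` /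
  `two_smul_quad_bpart_plaqWord` (`2•quad = curl² + plaqPairs` on either sort); and the DEGENERATE WORDS: `P22_plaq_degenerate`,
  `P22_plaqWord_self : P22 (p_{μμ}(x)) = 0` as a RING identity (the word `U U′ U′⁻¹ U⁻¹` is trivial), likewise `twistW_self`,
  `twist₂W_self`.
* §2 THE SUMMED `(2,2)`-JET `jet22 τ e W B = Σ_x Σ_{(μ,ν)} τ(P22(p_{μν}(x)))` over all sites and ordered direction pairs, the four summed
  forms `transport₂` (`Σ τ((lcurl W)·twist₂W)`), `seagull` (`Σ ½τ(twistW²)` — the square of the FIRST-order transport: the genuine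
  two-background-legs-on-one-fluctuation-line vertex), `spinTransport` (`Σ τ(qtwistW·F)`), `contact` (`Σ τ(quad_W·quad_B)`, with
  `four_smul_quad_mul_quad : 4•(quad_W·quad_B) = (curl_W² + plaqPairs_W)(F² + plaqPairs_B)`); the per-plaquette normal form
  `trace_P22_plaqWord` and **`jet22_split : jet22 = transport₂ + seagull + spinTransport + contact`** for every TRACIAL `𝕜`-linear `τ`;
  `jet22_eq_offDiag` (diagonal words contribute nothing); the two-parameter Taylor bookkeeping `sum_quartic_scale` (`jet22` is the
  `σ²t²`-coefficient of the fourth-order term of `Σ τ U` along `U_b = e^{σW_b}e^{tB_b}`, by `WilsonVertex2.quartic_map_scale`).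
* §3 CONSTANT FIELDS: `trace_P22_plaqWord_const` — at site-independent letters `W = X`, `B = Y` every plaquette carries
  `½τ(([Y_μ,X_ν] − [Y_ν,X_μ])²) + τ([X_μ,X_ν]·[Y_μ,Y_ν])`, the `(2,2)`-part of `½τ(F_{μν}²)` for the constant connection `X + Y`
  (`F_{μν} = [X_μ + Y_μ, X_ν + Y_ν]`): only `seagull` and `contact` survive — `transport₂` carries the factor `lcurl W = 0`
  (`transport₂_constW`), `spinTransport` the factor `F = lcurl B = 0` (`spinTransport_constB`);
  `jet22_const`.
* §4 Examples over `ℝ`, among them the ABELIAN CHECK: in a commutative algebra `P22(p_{μν}(x)) = ¼·(lcurl W)²·(lcurl B)²` (the `(2,2)`-part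
  of `(curl W + curl B)⁴/4!`).

NOT DONE HERE (successor nodes of the lineage): colour coordinates `W = Σ_a v_a t_a` and the `(v ⊗ v)`-bilinear forms with `B`-quadratic
colour matrices; polarisation in `B` and the per-background-pair 2-stencil tables in the `PlaquetteStencilData` format (distinct-bond and
contact index families); the fluctuation-colour traces; the symmetric one-matrix operator form; any value, any bound (the remainder bounds
of `Beta.TransportVertices` apply to plaquette words verbatim); gauge fixing / averaging; anything about `BetaPertH`.

GAPS record C-beta-an3-29 (HOME/GAPS.md of the cell).  All tags [folklore].
-/

noncomputable section

namespace Literature.MathematicalPhysics.QuantumFieldTheory.Balaban1983to89.Beta.PlaquetteVertex2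

open Finset
open scoped BigOperators
open Literature.MathematicalPhysics.QuantumFieldTheory.Balaban1983to89.Beta.TransportVertices
open Literature.MathematicalPhysics.QuantumFieldTheory.Balaban1983to89.Beta.WilsonVertex
open Literature.MathematicalPhysics.QuantumFieldTheory.Balaban1983to89.Beta.WilsonVertex2
open Literature.MathematicalPhysics.QuantumFieldTheory.Balaban1983to89.Beta.PlaquetteVertex (lcurl lcurl_self lcurl_const plaqWord twistW
  twistAux_plaqWord sum_wpart_plaqWord sum_bpart_plaqWord commSum_wpart_plaqWord)
open Literature.MathematicalPhysics.QuantumFieldTheory.Balaban1983to89.Beta.SpinTable (br plaqPairs plaqPairs_local)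

/-! ## §1 Lattice second-order transport functionals of a plaquette -/

section Functionals

variable (𝕜 : Type*) [RCLike 𝕜] {𝔸 : Type*} [NormedRing 𝔸] [NormedAlgebra 𝕜 𝔸]
variable {Λ : Type*} [AddCommGroup Λ] {D : Type*}

/-- **THE SECOND-ORDER TRANSPORT SUM** of the plaquette `p_{μν}(x)`: the `B`-QUADRATIC part of the transported fluctuation letters,
`ad₂(B₁, 0)(W₂) − ad₂(B₁+B₂−B₃, [B₁,B₂] − [B₁+B₂,B₃])(W₃) − ad₂(B₁+B₂−B₃−B₄, [B₁,B₂] − [B₁+B₂,B₃] − [B₁+B₂−B₃,B₄])(W₄)` with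
`ad₂(β,c)(x) = ½[β,[β,x]] + ½[c,x]` (`WilsonVertex2.ad₂`, the second-order term of `Ad(e^{B_1}⋯e^{B_m})x`; `β` the accumulated
background letters before the fluctuation letter along the contour, `c` their accumulated ordered commutators).  Lattice indexing
`B₁ = B_μ(x)`, `B₂ = B_ν(x+e_μ)`, `B₃ = B_μ(x+e_ν)`, `B₄ = B_ν(x)`, `W` likewise.  Ring level. [folklore] -/
def twist₂W (e : D → Λ) (W B : Λ → D → 𝔸) (x : Λ) (μ ν : D) : 𝔸 :=
  ad₂ 𝕜 (B x μ) 0 (W (x + e μ) ν)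
    - ad₂ 𝕜 (B x μ + B (x + e μ) ν - B (x + e ν) μ)
        (br (B x μ) (B (x + e μ) ν) - br (B x μ + B (x + e μ) ν) (B (x + e ν) μ)) (W (x + e ν) μ)
    - ad₂ 𝕜 (B x μ + B (x + e μ) ν - B (x + e ν) μ - B x ν)
        (br (B x μ) (B (x + e μ) ν) - br (B x μ + B (x + e μ) ν) (B (x + e ν) μ)
          - br (B x μ + B (x + e μ) ν - B (x + e ν) μ) (B x ν)) (W x ν)

variable (e : D → Λ) (W B : Λ → D → 𝔸) (x : Λ) (μ ν : D)

/-- `WilsonVertex2.twist₂Aux 0 0` of the plaquette word is `twist₂W` (`WilsonVertex2.twist₂_plaq` in lattice indexing). [folklore] -/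
theorem twist₂Aux_plaqWord : twist₂Aux 𝕜 0 0 (plaqWord e W B x μ ν) = twist₂W 𝕜 e W B x μ ν := by
  rw [plaqWord, twist₂_plaq, twist₂W]

/-- REGROUPING THE ACCUMULATED BACKGROUNDS through the plaquette field `F = lcurl e B x μ ν`: the accumulated letter sums are
`B₁+B₂−B₃ = F + B₄` and `B₁+B₂−B₃−B₄ = F`, the accumulated commutator sums are `[B₁,F] + [B₁,B₄] − [B₂,B₃]` and
`[B₁+B₄,F] + [B₁,B₄] − [B₂,B₃]`. [folklore] -/
theorem twist₂W_regroup : twist₂W 𝕜 e W B x μ ν =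
    ad₂ 𝕜 (B x μ) 0 (W (x + e μ) ν)
      - ad₂ 𝕜 (lcurl e B x μ ν + B x ν)
          (br (B x μ) (lcurl e B x μ ν) + br (B x μ) (B x ν) - br (B (x + e μ) ν) (B (x + e ν) μ)) (W (x + e ν) μ)
      - ad₂ 𝕜 (lcurl e B x μ ν)
          (br (B x μ + B x ν) (lcurl e B x μ ν) + br (B x μ) (B x ν) - br (B (x + e μ) ν) (B (x + e ν) μ)) (W x ν) := by
  have hc4 : br (B x μ) (B (x + e μ) ν) - br (B x μ + B (x + e μ) ν) (B (x + e ν) μ)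
      - br (B x μ + B (x + e μ) ν - B (x + e ν) μ) (B x ν) =
      br (B x μ + B x ν) (lcurl e B x μ ν) + br (B x μ) (B x ν) - br (B (x + e μ) ν) (B (x + e ν) μ) := by
    simp only [lcurl, br]; noncomm_ring
  have hc3 : br (B x μ) (B (x + e μ) ν) - br (B x μ + B (x + e μ) ν) (B (x + e ν) μ) =
      br (B x μ) (lcurl e B x μ ν) + br (B x μ) (B x ν) - br (B (x + e μ) ν) (B (x + e ν) μ) := by
    simp only [lcurl, br]; noncomm_ring
  have hb4 : B x μ + B (x + e μ) ν - B (x + e ν) μ - B x ν = lcurl e B x μ ν := by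
    simp only [lcurl]; abel
  have hb3 : B x μ + B (x + e μ) ν - B (x + e ν) μ = lcurl e B x μ ν + B x ν := by
    simp only [lcurl]; abel
  rw [twist₂W, hc4, hc3, hb4, hb3]

/-- **THE THREE-GRADED SPLIT OF THE SECOND-ORDER TRANSPORT**: `twist₂W` = an `F`-FREE part
`½[B₁,[B₁,W₂]] − ½[B₄,[B₄,W₃]] − ½[[B₁,B₄] − [B₂,B₃], W₃ + W₄]` (single undifferentiated background letters, twice) PLUS an `F`-LINEAR part
`−½([F,[B₄,W₃]] + [B₄,[F,W₃]]) − ½[[B₁,F],W₃] − ½[[B₁+B₄,F],W₄]` PLUS the `F`-QUADRATIC part `−½[F,[F, W₃ + W₄]]` (`F = lcurl e B x μ ν`).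
[folklore] -/
theorem twist₂W_split : twist₂W 𝕜 e W B x μ ν =
    ((2 : 𝕜)⁻¹ • br (B x μ) (br (B x μ) (W (x + e μ) ν)) - (2 : 𝕜)⁻¹ • br (B x ν) (br (B x ν) (W (x + e ν) μ))
        - (2 : 𝕜)⁻¹ • br (br (B x μ) (B x ν) - br (B (x + e μ) ν) (B (x + e ν) μ)) (W (x + e ν) μ + W x ν))
      - ((2 : 𝕜)⁻¹ • (br (lcurl e B x μ ν) (br (B x ν) (W (x + e ν) μ)) + br (B x ν) (br (lcurl e B x μ ν) (W (x + e ν) μ)))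
          + (2 : 𝕜)⁻¹ • br (br (B x μ) (lcurl e B x μ ν)) (W (x + e ν) μ)
          + (2 : 𝕜)⁻¹ • br (br (B x μ + B x ν) (lcurl e B x μ ν)) (W x ν))
      - (2 : 𝕜)⁻¹ • br (lcurl e B x μ ν) (br (lcurl e B x μ ν) (W (x + e ν) μ + W x ν)) := by
  rw [twist₂W_regroup]
  simp only [ad₂, br, mul_add, add_mul, mul_sub, sub_mul, smul_add, smul_sub, mul_assoc, zero_mul, mul_zero, sub_zero,
    add_zero, smul_zero]
  module

/-- **THE `B`-LINEAR TRANSPORTED-`quad` SUM** of the plaquette: the `B`-linear part of `quad` of the transported fluctuation letters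
(`WilsonVertex2.qtwistAux 0` of the plaquette word).  A definition asserting nothing. [folklore] -/
def qtwistW : 𝔸 := qtwistAux 𝕜 0 (plaqWord e W B x μ ν)

/-- `qtwistW` EXPLICITLY (`WilsonVertex2.qtwist_plaq` in lattice indexing): with the signed fluctuation letters
`(W₁, W₂, −W₃, −W₄)` and their first-order transports `(0, [B₁,W₂], −[B₁+B₂−B₃,W₃], −[B₁+B₂−B₃−B₄,W₄])` it is
`Σ_{i<i′}(A_i x_{i′} + x_i A_{i′}) + ½Σ_i (A_i x_i + x_i A_i)`. [folklore] -/
theorem qtwistW_eq : qtwistW 𝕜 e W B x μ ν =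
    W x μ * (br (B x μ) (W (x + e μ) ν) - br (B x μ + B (x + e μ) ν - B (x + e ν) μ) (W (x + e ν) μ)
        - br (B x μ + B (x + e μ) ν - B (x + e ν) μ - B x ν) (W x ν))
      + (br (B x μ) (W (x + e μ) ν) * (-W (x + e ν) μ - W x ν)
          + W (x + e μ) ν * (-br (B x μ + B (x + e μ) ν - B (x + e ν) μ) (W (x + e ν) μ)
              - br (B x μ + B (x + e μ) ν - B (x + e ν) μ - B x ν) (W x ν)))
      + (br (B x μ + B (x + e μ) ν - B (x + e ν) μ) (W (x + e ν) μ) * W x ν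
          + W (x + e ν) μ * br (B x μ + B (x + e μ) ν - B (x + e ν) μ - B x ν) (W x ν))
      + (2 : 𝕜)⁻¹ • ((br (B x μ) (W (x + e μ) ν) * W (x + e μ) ν + W (x + e μ) ν * br (B x μ) (W (x + e μ) ν))
          + (br (B x μ + B (x + e μ) ν - B (x + e ν) μ) (W (x + e ν) μ) * W (x + e ν) μ
              + W (x + e ν) μ * br (B x μ + B (x + e μ) ν - B (x + e ν) μ) (W (x + e ν) μ))
          + (br (B x μ + B (x + e μ) ν - B (x + e ν) μ - B x ν) (W x ν) * W x ν
              + W x ν * br (B x μ + B (x + e μ) ν - B (x + e ν) μ - B x ν) (W x ν))) := by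
  rw [qtwistW, plaqWord, qtwist_plaq]

omit [NormedAlgebra 𝕜 𝔸] in
/-- THE CONTACT-COMMUTATOR FUNCTIONAL of the plaquette (`WilsonVertex2.ctwistAux 0` of the plaquette word, regrouped through `F`):
`[W₁, twistW] + ([[B₁,W₂], −(W₃+W₄)] + [W₂, −[F+B₄,W₃] − [F,W₄]]) + ([[F+B₄,W₃],W₄] + [W₃,[F,W₄]])`.  `𝕜`-free. [folklore] -/
def ctwistW : 𝔸 :=
  br (W x μ) (twistW e W B x μ ν)
    + (br (br (B x μ) (W (x + e μ) ν)) (-W (x + e ν) μ - W x ν)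
        + br (W (x + e μ) ν) (-br (lcurl e B x μ ν + B x ν) (W (x + e ν) μ) - br (lcurl e B x μ ν) (W x ν)))
    + (br (br (lcurl e B x μ ν + B x ν) (W (x + e ν) μ)) (W x ν)
        + br (W (x + e ν) μ) (br (lcurl e B x μ ν) (W x ν)))

omit [NormedAlgebra 𝕜 𝔸] in
/-- `WilsonVertex2.ctwistAux 0` of the plaquette word is `ctwistW`. [folklore] -/
theorem ctwistAux_plaqWord : ctwistAux 0 (plaqWord e W B x μ ν) = ctwistW e W B x μ ν := by
  simp only [plaqWord, plaq, ctwistAux_consW, ctwistAux_consB, ctwistAux_nil, twistAux_consW_br, twistAux_consB, twistAux_nil,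
    wpart_consW, wpart_consB, wpart_nil, List.sum_cons, List.sum_nil, ctwistW, twistW, lcurl, br]
  noncomm_ring

/-- **`2•qtwistW = (lcurl W)·twistW + twistW·(lcurl W) + ctwistW`** (`WilsonVertex2.two_smul_qtwistAux` at the plaquette): the
`B`-linear transported `quad` is the symmetrised product of the fluctuation's curl with the first-order transport plus the contact
commutators. [folklore] -/
theorem two_smul_qtwistW : (2 : 𝕜) • qtwistW 𝕜 e W B x μ ν =
    (lcurl e W x μ ν * twistW e W B x μ ν + twistW e W B x μ ν * lcurl e W x μ ν) + ctwistW e W B x μ ν := by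
  rw [qtwistW, two_smul_qtwistAux, sum_wpart_plaqWord, twistAux_plaqWord, ctwistAux_plaqWord]

/-- `2•quad` of the FLUCTUATION letters of the plaquette is `(lcurl W)² + plaqPairs` (`TransportVertices.two_smul_quad`,
`PlaquetteVertex.sum_wpart_plaqWord`, `commSum_wpart_plaqWord`). [folklore] -/
theorem two_smul_quad_wpart_plaqWord : (2 : 𝕜) • quad 𝕜 (wpart (plaqWord e W B x μ ν)) =
    lcurl e W x μ ν * lcurl e W x μ ν + plaqPairs (W x μ) (W x ν) (W (x + e ν) μ) (W (x + e μ) ν) := by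
  rw [two_smul_quad, sum_wpart_plaqWord, commSum_wpart_plaqWord]

/-- `2•quad` of the BACKGROUND letters of the plaquette is `F² + plaqPairs` at the background letters. [folklore] -/
theorem two_smul_quad_bpart_plaqWord : (2 : 𝕜) • quad 𝕜 (bpart (plaqWord e W B x μ ν)) =
    lcurl e B x μ ν * lcurl e B x μ ν + plaqPairs (B x μ) (B x ν) (B (x + e ν) μ) (B (x + e μ) ν) := by
  rw [two_smul_quad, sum_bpart_plaqWord, plaqWord, bpart_plaq, commSum_wpart_plaq]

/-- `4•(quad_W · quad_B) = ((lcurl W)² + plaqPairs_W)·(F² + plaqPairs_B)`. [folklore] -/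
theorem four_smul_quad_mul_quad : (4 : 𝕜) • (quad 𝕜 (wpart (plaqWord e W B x μ ν)) * quad 𝕜 (bpart (plaqWord e W B x μ ν))) =
    (lcurl e W x μ ν * lcurl e W x μ ν + plaqPairs (W x μ) (W x ν) (W (x + e ν) μ) (W (x + e μ) ν))
      * (lcurl e B x μ ν * lcurl e B x μ ν + plaqPairs (B x μ) (B x ν) (B (x + e ν) μ) (B (x + e μ) ν)) := by
  rw [← two_smul_quad_wpart_plaqWord 𝕜 e W B x μ ν, ← two_smul_quad_bpart_plaqWord 𝕜 e W B x μ ν, smul_mul_assoc,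
    mul_smul_comm, smul_smul]
  norm_num

/-- **DEGENERATE WORDS CARRY NO JET** (ring level): for the trivial word `U U′ U′⁻¹ U⁻¹`, i.e. the letters
`plaq W₁ W₂ W₂ W₁ B₁ B₂ B₂ B₁`, the `(2,2)`-component vanishes identically. [folklore] -/
theorem P22_plaq_degenerate (W₁ W₂ B₁ B₂ : 𝔸) : P22 𝕜 (plaq W₁ W₂ W₂ W₁ B₁ B₂ B₂ B₁) = 0 := by
  simp only [plaq, P22_consW, P22_consB, P22_nil, P21_consW, P21_consB, P21_nil, P12_consW, P12_consB, P12_nil, P11_consW,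
    P11_consB, P11_nil, quad_cons, quad_nil, wpart_consW, wpart_consB, wpart_nil, bpart_consW, bpart_consB, bpart_nil,
    List.sum_cons, List.sum_nil]
  simp only [mul_add, smul_mul_assoc, mul_smul_comm, smul_smul, mul_assoc,
    mul_zero, zero_add, add_zero, neg_mul, mul_neg, neg_neg, smul_neg]
  module

/-- hence the DIAGONAL plaquette words `p_{μμ}(x)` carry no `(2,2)`-jet: `P22 (plaqWord e W B x μ μ) = 0`. [folklore] -/
theorem P22_plaqWord_self : P22 𝕜 (plaqWord e W B x μ μ) = 0 := by
  rw [plaqWord]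
  exact P22_plaq_degenerate 𝕜 _ _ _ _

omit [NormedAlgebra 𝕜 𝔸] in
/-- the first-order transport of a diagonal word vanishes. [folklore] -/
theorem twistW_self : twistW e W B x μ μ = 0 := by
  simp only [twistW, br]
  noncomm_ring

/-- the second-order transport of a diagonal word vanishes. [folklore] -/
theorem twist₂W_self : twist₂W 𝕜 e W B x μ μ = 0 := by
  simp only [twist₂W, ad₂, br, mul_add, add_mul, mul_sub, sub_mul, smul_add, smul_sub, mul_assoc, zero_mul, mul_zero, sub_zero,
    zero_add, add_zero, smul_zero, sub_self, add_sub_cancel_right]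
  module

end Functionals

/-! ## §2 The summed `(2,2)`-jet and its four-form normal form -/

section Summed

variable (𝕜 : Type*) [RCLike 𝕜] {𝔸 : Type*} [NormedRing 𝔸] [NormedAlgebra 𝕜 𝔸]
variable {V : Type*} [AddCommGroup V] [Module 𝕜 V]
variable {Λ : Type*} [Fintype Λ] [AddCommGroup Λ] {D : Type*} [Fintype D]

/-- **THE SUMMED `(2,2)`-JET**: the bidegree-`(W², B²)` Taylor component of `Σ_x Σ_{(μ,ν)} τ U(∂p_{μν}(x))` over ALL sites and ALL
ORDERED direction pairs (both orientations of every plaquette; the diagonal words contribute nothing, `jet22_eq_offDiag`);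
`−½·jet22` is the `(2,2)`-jet of `Σ (1 − Re τ U(∂p))` in the same bookkeeping as `PlaquetteVertex.jet21`. [folklore] -/
def jet22 (τ : 𝔸 →ₗ[𝕜] V) (e : D → Λ) (W B : Λ → D → 𝔸) : V :=
  ∑ x, ∑ μ, ∑ ν, τ (P22 𝕜 (plaqWord e W B x μ ν))

/-- THE SECOND-ORDER TRANSPORT FORM `Σ τ((lcurl W)_{μν}(x) · twist₂W)`: the fluctuation's curl against the `B`-quadratic transport of
the later fluctuation letters (vanishes termwise at constant `W`, where `lcurl W = 0`). [folklore] -/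
def transport₂ (τ : 𝔸 →ₗ[𝕜] V) (e : D → Λ) (W B : Λ → D → 𝔸) : V :=
  ∑ x, ∑ μ, ∑ ν, τ (lcurl e W x μ ν * twist₂W 𝕜 e W B x μ ν)

/-- **THE SEAGULL FORM** `Σ ½τ(twistW²)`: half the square of the FIRST-order transport `twistW` (`B`-linear, `W`-linear) — two
background legs on one fluctuation line. [folklore] -/
def seagull (τ : 𝔸 →ₗ[𝕜] V) (e : D → Λ) (W B : Λ → D → 𝔸) : V :=
  ∑ x, ∑ μ, ∑ ν, (2 : 𝕜)⁻¹ • τ (twistW e W B x μ ν * twistW e W B x μ ν)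

/-- THE SPIN–TRANSPORT FORM `Σ τ(qtwistW · F_{μν}(x))`: the plaquette field of the background against the `B`-linear transported
`quad` of the fluctuation letters (vanishes termwise at constant `B`, where `F = 0`; `two_smul_qtwistW`). [folklore] -/
def spinTransport (τ : 𝔸 →ₗ[𝕜] V) (e : D → Λ) (W B : Λ → D → 𝔸) : V :=
  ∑ x, ∑ μ, ∑ ν, τ (qtwistW 𝕜 e W B x μ ν * lcurl e B x μ ν)

/-- THE CONTACT FORM `Σ τ(quad(W-letters) · quad(B-letters))` (`four_smul_quad_mul_quad`: `¼ Σ τ((curl_W² + plaqPairs_W)(F² + plaqPairs_B))`).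
[folklore] -/
def contact (τ : 𝔸 →ₗ[𝕜] V) (e : D → Λ) (W B : Λ → D → 𝔸) : V :=
  ∑ x, ∑ μ, ∑ ν, τ (quad 𝕜 (wpart (plaqWord e W B x μ ν)) * quad 𝕜 (bpart (plaqWord e W B x μ ν)))

omit [Fintype Λ] [Fintype D] in
/-- **THE `(2,2)`-JET OF ONE PLAQUETTE IN FOUR FORMS** (`WilsonVertex2.trace_P22` at the plaquette word, lattice indexing):
`τ(P22(p)) = τ((lcurl W)·twist₂W) + ½τ(twistW²) + τ(qtwistW·F) + τ(quad_W·quad_B)`. [folklore] -/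
theorem trace_P22_plaqWord (τ : 𝔸 →ₗ[𝕜] V) (hτ : ∀ a b : 𝔸, τ (a * b) = τ (b * a)) (e : D → Λ) (W B : Λ → D → 𝔸)
    (x : Λ) (μ ν : D) :
    τ (P22 𝕜 (plaqWord e W B x μ ν)) =
      τ (lcurl e W x μ ν * twist₂W 𝕜 e W B x μ ν)
        + (2 : 𝕜)⁻¹ • τ (twistW e W B x μ ν * twistW e W B x μ ν)
        + τ (qtwistW 𝕜 e W B x μ ν * lcurl e B x μ ν)
        + τ (quad 𝕜 (wpart (plaqWord e W B x μ ν)) * quad 𝕜 (bpart (plaqWord e W B x μ ν))) := by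
  rw [trace_P22 𝕜 τ hτ, sum_wpart_plaqWord, sum_bpart_plaqWord, twistAux_plaqWord, twist₂Aux_plaqWord, qtwistW]

/-- **THE FOUR-FORM SPLIT**: `jet22 = transport₂ + seagull + spinTransport + contact`. [folklore] -/
theorem jet22_split (τ : 𝔸 →ₗ[𝕜] V) (hτ : ∀ a b : 𝔸, τ (a * b) = τ (b * a)) (e : D → Λ) (W B : Λ → D → 𝔸) :
    jet22 𝕜 τ e W B = transport₂ 𝕜 τ e W B + seagull 𝕜 τ e W B + spinTransport 𝕜 τ e W B + contact 𝕜 τ e W B := by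
  rw [jet22, transport₂, seagull, spinTransport, contact, ← Finset.sum_add_distrib, ← Finset.sum_add_distrib,
    ← Finset.sum_add_distrib]
  refine Finset.sum_congr rfl fun x _ => ?_
  rw [← Finset.sum_add_distrib, ← Finset.sum_add_distrib, ← Finset.sum_add_distrib]
  refine Finset.sum_congr rfl fun μ _ => ?_
  rw [← Finset.sum_add_distrib, ← Finset.sum_add_distrib, ← Finset.sum_add_distrib]
  refine Finset.sum_congr rfl fun ν _ => ?_
  exact trace_P22_plaqWord 𝕜 τ hτ e W B x μ ν

/-- the summed jet is a sum over the OFF-DIAGONAL ordered pairs only (`P22_plaqWord_self`). [folklore] -/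
theorem jet22_eq_offDiag [DecidableEq D] (τ : 𝔸 →ₗ[𝕜] V) (e : D → Λ) (W B : Λ → D → 𝔸) :
    jet22 𝕜 τ e W B = ∑ x, ∑ μ, ∑ ν ∈ Finset.univ.erase μ, τ (P22 𝕜 (plaqWord e W B x μ ν)) := by
  refine Finset.sum_congr rfl fun x _ => Finset.sum_congr rfl fun μ _ => ?_
  rw [Finset.sum_erase (f := fun ν => τ (P22 𝕜 (plaqWord e W B x μ ν))) Finset.univ
    (by rw [P22_plaqWord_self, map_zero])]

/-- **TWO-PARAMETER TAYLOR BOOKKEEPING**: along `U_b = e^{σW_b} e^{tB_b}` the fourth-order term of `Σ_x Σ_{(μ,ν)} τ U(∂p_{μν}(x))`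
splits by bidegree and `jet22` is its `σ²t²`-coefficient (`WilsonVertex2.quartic_map_scale`). [folklore] -/
theorem sum_quartic_scale (τ : 𝔸 →ₗ[𝕜] V) (e : D → Λ) (W B : Λ → D → 𝔸) (σ t : 𝕜) :
    ∑ x, ∑ μ, ∑ ν, τ (quartic 𝕜 ((plaqWord e W B x μ ν).map (scale 𝕜 σ t))) =
      σ ^ 4 • ∑ x, ∑ μ, ∑ ν, τ (quartic 𝕜 (wpart (plaqWord e W B x μ ν)))
        + (σ ^ 3 * t) • ∑ x, ∑ μ, ∑ ν, τ (P31 𝕜 (plaqWord e W B x μ ν))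
        + (σ ^ 2 * t ^ 2) • jet22 𝕜 τ e W B
        + (σ * t ^ 3) • ∑ x, ∑ μ, ∑ ν, τ (P13 𝕜 (plaqWord e W B x μ ν))
        + t ^ 4 • ∑ x, ∑ μ, ∑ ν, τ (quartic 𝕜 (bpart (plaqWord e W B x μ ν))) := by
  simp only [jet22, quartic_map_scale, map_add, map_smul, Finset.sum_add_distrib, Finset.smul_sum]

end Summed

/-! ## §3 Constant fields -/

section Constant

variable (𝕜 : Type*) [RCLike 𝕜] {𝔸 : Type*} [NormedRing 𝔸] [NormedAlgebra 𝕜 𝔸]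
variable {V : Type*} [AddCommGroup V] [Module 𝕜 V]
variable {Λ : Type*} [Fintype Λ] [AddCommGroup Λ] {D : Type*} [Fintype D]

omit [Fintype Λ] [Fintype D] in
/-- **CONSTANT LETTERS**: at site-independent `W = X`, `B = Y` every plaquette `p_{μν}(x)` carries
`½τ(([Y_μ,X_ν] − [Y_ν,X_μ])²) + τ([X_μ,X_ν]·[Y_μ,Y_ν])` — the `(2,2)`-part of `½τ(F_{μν}²)` for the CONSTANT connection `X + Y`,
`F_{μν} = [X_μ + Y_μ, X_ν + Y_ν]` (`WilsonVertex2.trace_P22_plaq_const`): only the seagull and the contact term survive. [folklore] -/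
theorem trace_P22_plaqWord_const (τ : 𝔸 →ₗ[𝕜] V) (hτ : ∀ a b : 𝔸, τ (a * b) = τ (b * a)) (e : D → Λ) (X Y : D → 𝔸)
    (x : Λ) (μ ν : D) :
    τ (P22 𝕜 (plaqWord e (fun _ => X) (fun _ => Y) x μ ν)) =
      (2 : 𝕜)⁻¹ • τ ((br (Y μ) (X ν) - br (Y ν) (X μ)) * (br (Y μ) (X ν) - br (Y ν) (X μ)))
        + τ (br (X μ) (X ν) * br (Y μ) (Y ν)) := by
  simp only [plaqWord]
  exact trace_P22_plaq_const 𝕜 τ hτ (X μ) (X ν) (Y μ) (Y ν)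

/-- hence the summed jet at constant letters: `|Λ|` copies of the direction double sum. [folklore] -/
theorem jet22_const (τ : 𝔸 →ₗ[𝕜] V) (hτ : ∀ a b : 𝔸, τ (a * b) = τ (b * a)) (e : D → Λ) (X Y : D → 𝔸) :
    jet22 𝕜 τ e (fun _ => X) (fun _ => Y) =
      Fintype.card Λ • ∑ μ : D, ∑ ν : D,
        ((2 : 𝕜)⁻¹ • τ ((br (Y μ) (X ν) - br (Y ν) (X μ)) * (br (Y μ) (X ν) - br (Y ν) (X μ)))
          + τ (br (X μ) (X ν) * br (Y μ) (Y ν))) := by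
  rw [jet22]
  simp only [trace_P22_plaqWord_const 𝕜 τ hτ]
  rw [Finset.sum_const, Finset.card_univ]

/-- at constant FLUCTUATION letters the second-order transport form vanishes termwise (factor `lcurl W = 0`,
`PlaquetteVertex.lcurl_const`). [folklore] -/
theorem transport₂_constW (τ : 𝔸 →ₗ[𝕜] V) (e : D → Λ) (X : D → 𝔸) (B : Λ → D → 𝔸) :
    transport₂ 𝕜 τ e (fun _ => X) B = 0 := by
  simp only [transport₂, lcurl_const, zero_mul, map_zero, Finset.sum_const_zero]

/-- at constant BACKGROUND letters the spin–transport form vanishes termwise (factor `F = lcurl B = 0`). [folklore] -/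
theorem spinTransport_constB (τ : 𝔸 →ₗ[𝕜] V) (e : D → Λ) (W : Λ → D → 𝔸) (Y : D → 𝔸) :
    spinTransport 𝕜 τ e W (fun _ => Y) = 0 := by
  simp only [spinTransport, lcurl_const, mul_zero, map_zero, Finset.sum_const_zero]

end Constant

/-! ## §4 Examples -/

section Examples

variable {Λ : Type*} [AddCommGroup Λ] {D : Type*}

/-- ABELIAN CHECK: in the commutative algebra `ℝ` the `(2,2)`-jet of a plaquette is `¼·(lcurl W)²·(lcurl B)²`
(the `(2,2)`-part of `(curl W + curl B)⁴/4!`). -/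
example (e : D → Λ) (W B : Λ → D → ℝ) (x : Λ) (μ ν : D) :
    P22 ℝ (plaqWord e W B x μ ν) = 4⁻¹ * ((lcurl e W x μ ν) ^ 2 * (lcurl e B x μ ν) ^ 2) := by
  simp only [plaqWord, plaq, P22_consW, P22_consB, P22_nil, P21_consW, P21_consB, P21_nil, P12_consW, P12_consB, P12_nil,
    P11_consW, P11_consB, P11_nil, quad_cons, quad_nil, wpart_consW, wpart_consB, wpart_nil, bpart_consW, bpart_consB, bpart_nil,
    List.sum_cons, List.sum_nil, lcurl, smul_eq_mul]
  ring

/-- the seagull of a diagonal word vanishes (`twistW_self`). -/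
example {𝔸 : Type*} [NormedRing 𝔸] (e : D → Λ) (W B : Λ → D → 𝔸) (x : Λ) (μ : D) :
    twistW e W B x μ μ * twistW e W B x μ μ = 0 := by
  rw [twistW_self, zero_mul]

/-- constant letters, one plaquette, `τ` the identity of a commutative `ℝ`: everything vanishes (all commutators do). -/
example (e : D → Λ) (X Y : D → ℝ) (x : Λ) (μ ν : D) :
    P22 ℝ (plaqWord e (fun _ => X) (fun _ => Y) x μ ν) = 0 := by
  have h := trace_P22_plaqWord_const ℝ (LinearMap.id : ℝ →ₗ[ℝ] ℝ) (fun a b => by simp [mul_comm]) e X Y x μ ν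
  simpa [br, mul_comm] using h

end Examples

end Literature.MathematicalPhysics.QuantumFieldTheory.Balaban1983to89.Beta.PlaquetteVertex2
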